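import Mathlib.Analysis.Convex.Topology
import Mathlib.Analysis.Convex.PathConnected
import Mathlib.Analysis.Complex.ReImTopology
import Mathlib.Combinatorics.SimpleGraph.Subgraph
import Literature.Probability.LatticeModels.CellDomain
import HarnessLib

/-!
# Cell domains: mesh edges, the discrete domain `Ω_δ`, connectedness

Topic `Literature/Probability/LatticeModels`; companion to `CellDomain.lean` (definition item
`defn-CellDomain`: the cell domain `CellDomain S δ = interior (⋃ v ∈ S, cutCell δ v)` of a finite
`S ⊆ ℤ²`, wanted by route SAWSchrammPassage of `Summits/CriticalPhenomena/SAWScalingLimit`).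
Here we prove that the canonical discretisation of `DomainDiscretisation.lean` applied to a cell
domain gives back `S` with its induced lattice edges, and that cell domains are domains.

## Contents (namespace `Literature.Probability.LatticeModels`; throughout `0 < δ`)

* `segment_meshPoint_subset_cellDomain` — the CLOSED mesh edge `[δu, δv]` between adjacent
  sites `u, v ∈ S` lies inside `CellDomain S δ` (through the open corridor covered by the two
  cells); hence `meshGraph_cellDomain_adj` (adjacent sites of `S` are joined in the mesh graph).
* For `S` inducing a preconnected subgraph of `ℤ²` (`((zdGraph 2).induce ↑S).Preconnected`):
  `meshVertexGraph_cellDomain_preconnected`, `meshDomain_cellDomain`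
  (**`meshDomain (CellDomain S δ) δ = S`**: the largest-component convention of Smirnov 2001,
  §2 is harmless here), `discreteDomainGraph_cellDomain_adj_iff` and
  `discreteDomainGraph_cellDomain` (**`Ω_δ` is the subgraph of `ℤ²` induced on `S`**, so that
  `SAW.DomainSAW (CellDomain S δ) δ a b` are exactly the self-avoiding lattice paths in `S`).
* `segment_subset_cellDomain_of_mem_cutCell`, `joinedIn_cellDomain_meshPoint`,
  `isConnected_cellDomain` (**a cell domain of a nonempty `S` inducing a preconnected subgraph
  is open, bounded and connected**, i.e. a domain).
* `induce_preconnected_of_isPreconnected_cellDomain`, `isConnected_cellDomain_iff` — the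
  converse: a (pre)connected cell domain comes from an `S` inducing a preconnected subgraph (so
  the hypothesis `D.carrier = CellDomain S δ` for a Jordan/Dobrushin domain `D` in the route items
  already forces `S` to be lattice-connected, and the lemmas above apply).

## What is NOT here

* Side midpoints `(δp + δp')/2` (`p ∈ S`, `p' ∉ S` adjacent) lie on the frontier:
  `CellDomainBoundary.lean`. The Jordan / `DobrushinDomain` structure of simply connected cell
  domains and the SAW domain Markov property are further items (see `CellDomain.lean`).

## References

* S. Smirnov, *Critical percolation in the plane*, C. R. Acad. Sci. Paris 333 (2001), §2
  (largest-component discretisation).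
* D. Chelkak, S. Smirnov, Invent. Math. 189 (2012), §4 (polygonal domains).

Mathlib anchors: `Set.reProdIm` (`×ℂ`), `segment_eq_image'`, `insert_endpoints_openSegment`,
`Convex.openSegment_interior_self_subset_interior`, `JoinedIn.of_segment_subset`,
`IsPathConnected.isConnected`, `IsPreconnected`, `SimpleGraph.Reachable.map`,
`SimpleGraph.Preconnected.subsingleton_connectedComponent`, `SimpleGraph.Subgraph.induce`.
-/

noncomputable section

open Set Metric Complex

namespace Literature.Probability.LatticeModels

variable {S : Finset (Site 2)} {δ : ℝ} {u v : Site 2} {w : ℂ}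

/-! ### Mesh edges inside a cell domain -/

/-- One lattice step in a coordinate direction: the closed mesh edge from `δu` to `δ(u + eᵢ)`
lies in the cell domain as soon as both endpoints are sites of `S` (`δ > 0`). It lies in the open
corridor `(-δ/2, 3δ/2) × (-2δ/5, 2δ/5)` (coordinates along / across the edge, centred at `δu`),
which is covered by the two cells. [folklore] -/
theorem segment_meshPoint_add_single_subset_cellDomain (hδ : 0 < δ) (i : Fin 2) (hu : u ∈ S)
    (hv : u + Pi.single i 1 ∈ S) :
    segment ℝ (meshPoint δ u) (meshPoint δ (u + Pi.single i 1)) ⊆ CellDomain S δ := by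
  -- an open corridor `R` around the edge, covered by the two cells
  obtain ⟨R, hRo, hRsub, hseg⟩ : ∃ R : Set ℂ, IsOpen R ∧
      R ⊆ cutCell δ u ∪ cutCell δ (u + Pi.single i 1) ∧
      segment ℝ (meshPoint δ u) (meshPoint δ (u + Pi.single i 1)) ⊆ R := by
    have h10 : (1 : Fin 2) ≠ 0 := by decide
    have h01 : (0 : Fin 2) ≠ 1 := by decide
    obtain rfl | rfl : i = 0 ∨ i = 1 := match i with | 0 => Or.inl rfl | 1 => Or.inr rfl
    · -- a horizontal edge
      have hre : (meshPoint δ (u + Pi.single (0 : Fin 2) 1)).re = (meshPoint δ u).re + δ := by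
        rw [meshPoint_re, meshPoint_re]
        simp only [Pi.add_apply, Pi.single_eq_same, Int.cast_add, Int.cast_one]
        ring
      have him : (meshPoint δ (u + Pi.single (0 : Fin 2) 1)).im = (meshPoint δ u).im := by
        rw [meshPoint_im, meshPoint_im]
        simp only [Pi.add_apply, Pi.single_eq_of_ne h10, add_zero]
      refine ⟨Ioo ((meshPoint δ u).re - δ / 2) ((meshPoint δ u).re + 3 * δ / 2) ×ℂ
          Ioo ((meshPoint δ u).im - 2 * δ / 5) ((meshPoint δ u).im + 2 * δ / 5),
        isOpen_Ioo.reProdIm isOpen_Ioo, fun w hw => ?_, ?_⟩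
      · rw [mem_reProdIm, mem_Ioo, mem_Ioo] at hw
        obtain ⟨⟨h1, h2⟩, h3, h4⟩ := hw
        have k2 : |w.im - (meshPoint δ u).im| ≤ 2 * δ / 5 := abs_le.2 ⟨by linarith, by linarith⟩
        by_cases hw1 : w.re ≤ (meshPoint δ u).re + δ / 2
        · have k1 : |w.re - (meshPoint δ u).re| ≤ δ / 2 := abs_le.2 ⟨by linarith, by linarith⟩
          exact Or.inl ⟨k1, k2.trans (by linarith), by linarith⟩
        · rw [not_le] at hw1
          refine Or.inr ?_
          rw [mem_cutCell_iff, hre, him]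
          have k1 : |w.re - ((meshPoint δ u).re + δ)| ≤ δ / 2 :=
            abs_le.2 ⟨by linarith, by linarith⟩
          exact ⟨k1, k2.trans (by linarith), by linarith⟩
      · rw [segment_eq_image']
        rintro _ ⟨θ, ⟨h0, h1⟩, rfl⟩
        rw [mem_reProdIm]
        simp only [add_re, add_im, smul_re, smul_im, sub_re, sub_im, smul_eq_mul, hre, him,
          mem_Ioo]
        have k0 : 0 ≤ θ * δ := mul_nonneg h0 hδ.le
        have k1 : θ * δ ≤ δ := mul_le_of_le_one_left hδ.le h1
        constructor <;> constructor <;> nlinarith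
    · -- a vertical edge
      have hre : (meshPoint δ (u + Pi.single (1 : Fin 2) 1)).re = (meshPoint δ u).re := by
        rw [meshPoint_re, meshPoint_re]
        simp only [Pi.add_apply, Pi.single_eq_of_ne h01, add_zero]
      have him : (meshPoint δ (u + Pi.single (1 : Fin 2) 1)).im = (meshPoint δ u).im + δ := by
        rw [meshPoint_im, meshPoint_im]
        simp only [Pi.add_apply, Pi.single_eq_same, Int.cast_add, Int.cast_one]
        ring
      refine ⟨Ioo ((meshPoint δ u).re - 2 * δ / 5) ((meshPoint δ u).re + 2 * δ / 5) ×ℂ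
          Ioo ((meshPoint δ u).im - δ / 2) ((meshPoint δ u).im + 3 * δ / 2),
        isOpen_Ioo.reProdIm isOpen_Ioo, fun w hw => ?_, ?_⟩
      · rw [mem_reProdIm, mem_Ioo, mem_Ioo] at hw
        obtain ⟨⟨h1, h2⟩, h3, h4⟩ := hw
        have k1 : |w.re - (meshPoint δ u).re| ≤ 2 * δ / 5 := abs_le.2 ⟨by linarith, by linarith⟩
        by_cases hw2 : w.im ≤ (meshPoint δ u).im + δ / 2
        · have k2 : |w.im - (meshPoint δ u).im| ≤ δ / 2 := abs_le.2 ⟨by linarith, by linarith⟩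
          exact Or.inl ⟨k1.trans (by linarith), k2, by linarith⟩
        · rw [not_le] at hw2
          refine Or.inr ?_
          rw [mem_cutCell_iff, hre, him]
          have k2 : |w.im - ((meshPoint δ u).im + δ)| ≤ δ / 2 :=
            abs_le.2 ⟨by linarith, by linarith⟩
          exact ⟨k1.trans (by linarith), k2, by linarith⟩
      · rw [segment_eq_image']
        rintro _ ⟨θ, ⟨h0, h1⟩, rfl⟩
        rw [mem_reProdIm]
        simp only [add_re, add_im, smul_re, smul_im, sub_re, sub_im, smul_eq_mul, hre, him,
          mem_Ioo]
        have k0 : 0 ≤ θ * δ := mul_nonneg h0 hδ.le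
        have k1 : θ * δ ≤ δ := mul_le_of_le_one_left hδ.le h1
        constructor <;> constructor <;> nlinarith
  refine hseg.trans (interior_maximal (hRsub.trans ?_) hRo)
  exact union_subset (fun _ hz => mem_iUnion₂.2 ⟨u, hu, hz⟩)
    (fun _ hz => mem_iUnion₂.2 ⟨_, hv, hz⟩)

/-- **Closed mesh edges of `S` lie inside the cell domain** (`δ > 0`): for adjacent sites
`u, v ∈ S` of `ℤ²`, the closed segment `[δu, δv]` is contained in `CellDomain S δ` (not only in
its closure). [folklore] -/
theorem segment_meshPoint_subset_cellDomain (hδ : 0 < δ) (hu : u ∈ S) (hv : v ∈ S)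
    (h : (zdGraph 2).Adj u v) :
    segment ℝ (meshPoint δ u) (meshPoint δ v) ⊆ CellDomain S δ := by
  obtain ⟨i, rfl | rfl⟩ := (zdGraph_adj_iff u v).1 h
  · exact segment_meshPoint_add_single_subset_cellDomain hδ i hu hv
  · rw [segment_symm]
    exact segment_meshPoint_add_single_subset_cellDomain hδ i hv hu

/-- Adjacent sites of `S` are adjacent in the mesh graph of the cell domain (`δ > 0`): the closed
mesh edge lies in the domain, a fortiori in its closure. [folklore] -/
theorem meshGraph_cellDomain_adj (hδ : 0 < δ) (hu : u ∈ S) (hv : v ∈ S)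
    (h : (zdGraph 2).Adj u v) : (meshGraph (CellDomain S δ) δ).Adj u v :=
  meshGraph_adj_iff.2 ⟨h, (segment_meshPoint_subset_cellDomain hδ hu hv h).trans subset_closure⟩

/-! ### The discrete domain of a cell domain -/

/-- If `S` induces a preconnected subgraph of `ℤ²`, the mesh graph of `CellDomain S δ` on its
mesh vertices (`= S`) is preconnected (`δ > 0`). [folklore] -/
theorem meshVertexGraph_cellDomain_preconnected (hδ : 0 < δ)
    (hS : ((zdGraph 2).induce (S : Set (Site 2))).Preconnected) :
    (meshVertexGraph (CellDomain S δ) δ).Preconnected := by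
  -- the identity is a graph homomorphism from the induced lattice graph on `S`
  let φ : (zdGraph 2).induce (S : Set (Site 2)) →g meshVertexGraph (CellDomain S δ) δ :=
    { toFun := fun x => ⟨x.1, (mem_meshVertices_cellDomain_iff hδ).2 x.2⟩
      map_rel' := fun {a b} hab => meshGraph_cellDomain_adj hδ a.2 b.2 hab }
  rintro ⟨x, hx⟩ ⟨y, hy⟩
  exact (hS ⟨x, (mem_meshVertices_cellDomain_iff hδ).1 hx⟩
    ⟨y, (mem_meshVertices_cellDomain_iff hδ).1 hy⟩).map φ

/-- **The discrete domain of a cell domain is `S`** (`δ > 0`, `S` inducing a preconnected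
subgraph of `ℤ²`): the largest-component discretisation `meshDomain` of `DomainDiscretisation.lean`
returns exactly `S`. [folklore] -/
theorem meshDomain_cellDomain (hδ : 0 < δ)
    (hS : ((zdGraph 2).induce (S : Set (Site 2))).Preconnected) :
    meshDomain (CellDomain S δ) δ = ↑S := by
  refine ((meshDomain_subset_meshVertices _ _).trans (meshVertices_cellDomain hδ S).subset).antisymm
    fun x hx => ?_
  have hxV : x ∈ meshVertices (CellDomain S δ) δ := (mem_meshVertices_cellDomain_iff hδ).2 hx
  have hsub := (meshVertexGraph_cellDomain_preconnected hδ hS).subsingleton_connectedComponent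
  simp only [meshDomain, mem_iUnion, mem_image]
  refine ⟨(meshVertexGraph (CellDomain S δ) δ).connectedComponentMk ⟨x, hxV⟩, fun C' => ?_,
    ⟨x, hxV⟩, (SimpleGraph.ConnectedComponent.mem_supp_iff _ _).2 rfl, rfl⟩
  rw [Subsingleton.elim C' ((meshVertexGraph (CellDomain S δ) δ).connectedComponentMk ⟨x, hxV⟩)]

/-- **`Ω_δ` of a cell domain is the subgraph of `ℤ²` induced on `S`** (`δ > 0`, `S` inducing a
preconnected subgraph): adjacency in `discreteDomainGraph (CellDomain S δ) δ` is adjacency in `ℤ²`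
between sites of `S`. [folklore] -/
theorem discreteDomainGraph_cellDomain_adj_iff (hδ : 0 < δ)
    (hS : ((zdGraph 2).induce (S : Set (Site 2))).Preconnected) {x y : Site 2} :
    (discreteDomainGraph (CellDomain S δ) δ).Adj x y ↔ (zdGraph 2).Adj x y ∧ x ∈ S ∧ y ∈ S := by
  rw [discreteDomainGraph_adj_iff, meshDomain_cellDomain hδ hS, Finset.mem_coe, Finset.mem_coe]
  exact ⟨fun h => ⟨meshGraph_le_zdGraph _ _ h.1, h.2⟩,
    fun h => ⟨meshGraph_cellDomain_adj hδ h.2.1 h.2.2 h.1, h.2⟩⟩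

/-- **`Ω_δ` of a cell domain is the subgraph of `ℤ²` induced on `S`**, as an equality of simple
graphs on `Site 2` (the induced subgraph viewed as a spanning subgraph, sites outside `S`
isolated). [folklore] -/
theorem discreteDomainGraph_cellDomain (hδ : 0 < δ)
    (hS : ((zdGraph 2).induce (S : Set (Site 2))).Preconnected) :
    discreteDomainGraph (CellDomain S δ) δ =
      ((⊤ : (zdGraph 2).Subgraph).induce (S : Set (Site 2))).spanningCoe := by
  ext x y
  rw [discreteDomainGraph_cellDomain_adj_iff hδ hS, SimpleGraph.Subgraph.spanningCoe_adj,
    SimpleGraph.Subgraph.induce_adj, SimpleGraph.Subgraph.top_adj, Finset.mem_coe, Finset.mem_coe]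
  tauto

/-! ### Connectedness -/

/-- A point of the cell domain lying in the cell of `v ∈ S` sees the centre `δv` inside the
domain: the closed segment `[δv, w]` lies in `CellDomain S δ` (convexity of the cell, whose
interior lies in the domain). [folklore] -/
theorem segment_subset_cellDomain_of_mem_cutCell (hδ : 0 < δ) (hv : v ∈ S)
    (hwv : w ∈ cutCell δ v) (hw : w ∈ CellDomain S δ) :
    segment ℝ (meshPoint δ v) w ⊆ CellDomain S δ := by
  have hc := meshPoint_mem_interior_cutCell hδ v
  have hint := interior_cutCell_subset_cellDomain hv δ
  rw [← insert_endpoints_openSegment]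
  refine insert_subset (hint hc) (insert_subset hw ?_)
  exact ((convex_cutCell δ v).openSegment_interior_self_subset_interior hc hwv).trans hint

/-- Mesh points of sites of `S` are joined inside the cell domain when `S` induces a preconnected
subgraph of `ℤ²` (`δ > 0`): follow the closed mesh edges of a lattice path in `S`. [folklore] -/
theorem joinedIn_cellDomain_meshPoint (hδ : 0 < δ)
    (hS : ((zdGraph 2).induce (S : Set (Site 2))).Preconnected) (hu : u ∈ S) (hv : v ∈ S) :
    JoinedIn (CellDomain S δ) (meshPoint δ u) (meshPoint δ v) := by
  obtain ⟨p⟩ := hS ⟨u, hu⟩ ⟨v, hv⟩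
  suffices key : ∀ (a b : (S : Set (Site 2))), ((zdGraph 2).induce (S : Set (Site 2))).Walk a b →
      JoinedIn (CellDomain S δ) (meshPoint δ a) (meshPoint δ b) from key _ _ p
  intro a b q
  induction q with
  | nil => exact JoinedIn.refl (meshPoint_mem_cellDomain hδ ‹(S : Set (Site 2))›.2)
  | cons h _ ih =>
    exact (JoinedIn.of_segment_subset
      (segment_meshPoint_subset_cellDomain hδ (Subtype.prop _) (Subtype.prop _) h)).trans ih

/-- **A cell domain is a domain**: for `δ > 0` and a nonempty `S` inducing a preconnected
subgraph of `ℤ²`, `CellDomain S δ` is (open, bounded and) connected — every point is joined to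
the centre of a cell containing it, and centres are joined along mesh edges. [folklore] -/
theorem isConnected_cellDomain (hδ : 0 < δ) (hne : S.Nonempty)
    (hS : ((zdGraph 2).induce (S : Set (Site 2))).Preconnected) :
    IsConnected (CellDomain S δ) := by
  refine IsPathConnected.isConnected ?_
  obtain ⟨v₀, hv₀⟩ := hne
  refine ⟨meshPoint δ v₀, meshPoint_mem_cellDomain hδ hv₀, fun w hw => ?_⟩
  obtain ⟨v, hv, hwv⟩ := exists_mem_cutCell_of_mem_cellDomain hw
  exact (joinedIn_cellDomain_meshPoint hδ hS hv₀ hv).trans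
    (JoinedIn.of_segment_subset (segment_subset_cellDomain_of_mem_cutCell hδ hv hwv hw))

/-- **Converse: a connected cell domain comes from a connected set of sites** (`δ > 0`): if
`CellDomain S δ` is preconnected then `S` induces a preconnected subgraph of `ℤ²`. Otherwise split
`S` into the lattice component `A` of a site `x` and the rest `B ∋ y`; cells of `A` and of `B` are
pairwise disjoint (`disjoint_cutCell`: distinct, non-adjacent sites), so the complements of the
two closed unions separate the domain, `δx` from `δy`. [folklore] -/
theorem induce_preconnected_of_isPreconnected_cellDomain (hδ : 0 < δ)
    (hconn : IsPreconnected (CellDomain S δ)) :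
    ((zdGraph 2).induce (S : Set (Site 2))).Preconnected := by
  classical
  rintro ⟨x, hx⟩ ⟨y, hy⟩
  by_contra hxy
  set G := (zdGraph 2).induce (S : Set (Site 2)) with hG
  -- the lattice component of `x` inside `S`, and the rest of `S`
  set A : Finset (Site 2) := S.filter fun v => ∃ hv : v ∈ S, G.Reachable ⟨x, hx⟩ ⟨v, hv⟩ with hA
  set B : Finset (Site 2) := S.filter fun v => ∀ hv : v ∈ S, ¬ G.Reachable ⟨x, hx⟩ ⟨v, hv⟩ with hB
  have hxA : x ∈ A := Finset.mem_filter.2 ⟨hx, hx, SimpleGraph.Reachable.refl _⟩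
  have hyB : y ∈ B := Finset.mem_filter.2 ⟨hy, fun _ h => hxy h⟩
  have hcover : ∀ v ∈ S, v ∈ A ∨ v ∈ B := fun v hv => by
    by_cases h : G.Reachable ⟨x, hx⟩ ⟨v, hv⟩
    · exact Or.inl (Finset.mem_filter.2 ⟨hv, hv, h⟩)
    · exact Or.inr (Finset.mem_filter.2 ⟨hv, fun _ => h⟩)
  -- cells of `A` and cells of `B` are disjoint: distinct and non-adjacent sites
  have hdisj : ∀ a ∈ A, ∀ b ∈ B, Disjoint (cutCell δ a) (cutCell δ b) := by
    intro a ha b hb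
    obtain ⟨-, haS, hra⟩ := Finset.mem_filter.1 ha
    obtain ⟨hbS, hrb⟩ := Finset.mem_filter.1 hb
    refine disjoint_cutCell hδ ?_ fun hab => ?_
    · rintro rfl
      exact hrb haS hra
    · exact hrb hbS (hra.trans (SimpleGraph.Adj.reachable (show G.Adj ⟨a, haS⟩ ⟨b, hbS⟩ from hab)))
  have hKAB : Disjoint (⋃ v ∈ A, cutCell δ v) (⋃ v ∈ B, cutCell δ v) := by
    simp only [disjoint_iUnion_left, disjoint_iUnion_right]
    exact fun b hb a ha => hdisj a ha b hb
  have hΩsub : CellDomain S δ ⊆ (⋃ v ∈ A, cutCell δ v) ∪ ⋃ v ∈ B, cutCell δ v := by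
    intro w hw
    obtain ⟨v, hv, hwv⟩ := exists_mem_cutCell_of_mem_cellDomain hw
    rcases hcover v hv with h | h
    · exact Or.inl (mem_iUnion₂.2 ⟨v, h, hwv⟩)
    · exact Or.inr (mem_iUnion₂.2 ⟨v, h, hwv⟩)
  -- the complements of the two closed unions separate the domain
  have h1 : (CellDomain S δ ∩ (⋃ v ∈ B, cutCell δ v)ᶜ).Nonempty :=
    ⟨meshPoint δ x, meshPoint_mem_cellDomain hδ hx, Set.disjoint_left.1 hKAB
      (mem_iUnion₂.2 ⟨x, hxA, meshPoint_mem_cutCell hδ.le x⟩)⟩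
  have h2 : (CellDomain S δ ∩ (⋃ v ∈ A, cutCell δ v)ᶜ).Nonempty :=
    ⟨meshPoint δ y, meshPoint_mem_cellDomain hδ hy, Set.disjoint_right.1 hKAB
      (mem_iUnion₂.2 ⟨y, hyB, meshPoint_mem_cutCell hδ.le y⟩)⟩
  have hcov : CellDomain S δ ⊆ (⋃ v ∈ B, cutCell δ v)ᶜ ∪ (⋃ v ∈ A, cutCell δ v)ᶜ := by
    intro w hw
    rcases hΩsub hw with h | h
    · exact Or.inl (Set.disjoint_left.1 hKAB h)
    · exact Or.inr (Set.disjoint_right.1 hKAB h)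
  obtain ⟨w, hwΩ, hwB, hwA⟩ := hconn _ _ (isClosed_iUnion_cutCell B δ).isOpen_compl
    (isClosed_iUnion_cutCell A δ).isOpen_compl hcov h1 h2
  rcases hΩsub hwΩ with h | h
  · exact hwA h
  · exact hwB h

/-- **A cell domain is connected iff its set of sites is** (`δ > 0`): `CellDomain S δ` is
connected iff `S` is nonempty and induces a preconnected subgraph of `ℤ²`. [folklore] -/
theorem isConnected_cellDomain_iff (hδ : 0 < δ) :
    IsConnected (CellDomain S δ) ↔
      S.Nonempty ∧ ((zdGraph 2).induce (S : Set (Site 2))).Preconnected :=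
  ⟨fun h => ⟨(cellDomain_nonempty_iff hδ).1 h.nonempty,
    induce_preconnected_of_isPreconnected_cellDomain hδ h.isPreconnected⟩,
    fun h => isConnected_cellDomain hδ h.1 h.2⟩

end Literature.Probability.LatticeModels
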